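import Literature.ModelTheory.ExponentialFields.PilaWilkieUnaryParametrization
import Mathlib.Analysis.Calculus.MeanValue
import HarnessLib

/-!
# Uniform monotone pieces and normalized strictly monotone charts (Bhardwaj–van den Dries 2022, §4/§6)

Topic `Literature/ModelTheory/ExponentialFields`; proof file in the cone of the named fact
`PilaWilkie2006_thm_1_8`.  Uniform-in-parameters versions over `ℝ` of two routine steps of
Bhardwaj–van den Dries 2022 (proofs of Thm. 4.3 and Lemma 6.2): *"by partitioning (0,1)
further and composing with linear functions we arrange that each `φ ∈ Φ` is given by
normalized strictly monotone functions; we throw away the constant ones, replacing `𝕀` by a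
cofinite subset"*.

* `uniform_monotone_pieces` — for finitely many definable families of functions
  differentiable on `(0,1)`: uniformly many definable gaps on which each function is strictly
  monotone, all other values lying in a finite set (Monotonicity via boundary points of the
  sign sets of the derivative, uniform finiteness, `nthPointT` enumeration);
* `exists_firstActive` — redirecting inactive indices to an active chart, definably;
* `normalized_charts` — the resulting finitely many definable families of strictly monotone
  `C^r` charts `(0,1) → (0,1)` with `|φ^{(i)}| ≤ 1`, each an affine reparametrization of one of
  the given functions over a gap, covering `(0,1)` up to finitely many points.

Nothing here is a named fact; no definitions.

## References

* N. Bhardwaj, L. van den Dries, *On the Pila–Wilkie theorem*, Expo. Math. 40 (2022),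
  proofs of Thm. 4.3 and Lemma 6.2. [BhardwajVanDenDries2022]
* L. van den Dries, *Tame topology and o-minimal structures*, CUP 1998, Ch. 3 (1.2).
  [Dries1998]
-/

noncomputable section

open Set FirstOrder FirstOrder.Language Filter Topology Function

namespace Literature.ModelTheory.ExponentialFields

/-! ### Uniform monotone pieces of a definable family of differentiable unary functions -/

section MonotonePieces

open CellDecomposition Classical

variable {L : Language} [L.Structure ℝ]

/-- **Uniform monotonicity pieces** (van den Dries 1998, Ch. 3 (1.2) Monotonicity, made uniform
in parameters by uniform finiteness; the step *"partitioning (0,1) further and composing with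
linear functions we arrange that each `φ ∈ Φ` is given by normalized strictly monotone
functions; throw away the constant ones"* in Bhardwaj–van den Dries 2022, proofs of Thm. 4.3
and Lemma 6.2): for finitely many definable families `Ψ_j(v, ·)` of functions differentiable
on `(0,1)` there are `N`, definable gap ends `α_{ji}(v) < β_{ji}(v)` and definable activity
conditions such that each active gap lies in `(0,1)` and carries a strictly monotone
`Ψ_j(v,·)`, and every value `Ψ_j(v,t)`, `t ∈ (0,1)` outside the active gaps of `j`, lies in
a finite set `E_v`. [cite: Dries1998, Ch. 3 (1.2)] [cite: BhardwajVanDenDries2022, Lemma 6.2 (proof)] -/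
theorem uniform_monotone_pieces (hO : L.IsOMinimal ℝ)
    (hadd : (univ : Set ℝ).Definable L {v : Fin 3 → ℝ | v 0 + v 1 = v 2})
    (hmul : (univ : Set ℝ).Definable L {v : Fin 3 → ℝ | v 0 * v 1 = v 2})
    {q : ℕ} {J : Type} [Fintype J] (Ψ : J → (Fin q → ℝ) → ℝ → ℝ)
    (hΨ : ∀ j, IsDefinableFamily₁ L (Ψ j)) (hdiff : ∀ j v, DifferentiableOn ℝ (Ψ j v) (Ioo 0 1)) :
    ∃ (N : ℕ) (α β : J → Fin N → (Fin q → ℝ) → ℝ) (Act : J → Fin N → (Fin q → ℝ) → Prop),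
      (∀ j i, (univ : Set ℝ).DefinableFun L (α j i)) ∧ (∀ j i, (univ : Set ℝ).DefinableFun L (β j i)) ∧
      (∀ j i, (univ : Set ℝ).Definable L {v | Act j i v}) ∧
      ∀ v, (∀ j i, Act j i v → α j i v < β j i v ∧ Ioo (α j i v) (β j i v) ⊆ Ioo 0 1 ∧
            (StrictMonoOn (Ψ j v) (Ioo (α j i v) (β j i v)) ∨ StrictAntiOn (Ψ j v) (Ioo (α j i v) (β j i v)))) ∧
        ∃ E : Set ℝ, E.Finite ∧ ∀ j, ∀ t ∈ Ioo (0 : ℝ) 1,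
          Ψ j v t ∈ E ∨ ∃ i, Act j i v ∧ t ∈ Ioo (α j i v) (β j i v) := by
  have hlt := definable_lt_of_field hadd hmul
  -- derivative families and their sign sets
  set D : J → (Fin q → ℝ) → ℝ → ℝ := fun j v y => deriv (Ψ j v) y with hD
  have hDdef : ∀ j, IsDefinableFamily₁ L (D j) := fun j => (hΨ j).deriv hadd hmul
  -- break points: `0`, `1`, and boundary points in `(0,1)` of the sign sets
  set Bad : J → (Fin q → ℝ) → ℝ → Prop := fun j v x =>
    x = 0 ∨ x = 1 ∨ ((0 < x ∧ x < 1) ∧ (IsBd {y | 0 < D j v y} x ∨ IsBd {y | D j v y < 0} x)) with hBad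
  ----------------------------------------------------------------- (1) definability
  have hq' : (univ : Set ℝ).DefinableMap L (fun (w : Fin q ⊕ Unit → ℝ) (i : Fin q) => w (Sum.inl i)) :=
    fun i => definableFun_proj _
  have ht' : (univ : Set ℝ).DefinableFun L (fun w : Fin q ⊕ Unit → ℝ => w (Sum.inr ())) := definableFun_proj _
  have hPos : ∀ j, (univ : Set ℝ).Definable L {w : Fin q ⊕ Unit → ℝ |
      (fun v y => 0 < D j v y) (fun i => w (Sum.inl i)) (w (Sum.inr ()))} := fun j =>
    definable_setOf_lt hlt (definableFun_const' _ _) ((hDdef j).definableFun hq' ht')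
  have hNeg : ∀ j, (univ : Set ℝ).Definable L {w : Fin q ⊕ Unit → ℝ |
      (fun v y => D j v y < 0) (fun i => w (Sum.inl i)) (w (Sum.inr ()))} := fun j =>
    definable_setOf_lt hlt ((hDdef j).definableFun hq' ht') (definableFun_const' _ _)
  have hBadDef : ∀ j, (univ : Set ℝ).Definable L
      {w : Fin q ⊕ Unit → ℝ | Bad j (fun i => w (Sum.inl i)) (w (Sum.inr ()))} := by
    intro j
    simp only [hBad]
    refine definable_setOf_or (definable_setOf_eq' ht' (definableFun_const' _ _))
      (definable_setOf_or (definable_setOf_eq' ht' (definableFun_const' _ _))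
        (definable_setOf_and (definable_setOf_and (definable_setOf_lt hlt (definableFun_const' _ _) ht')
          (definable_setOf_lt hlt ht' (definableFun_const' _ _)))
          (definable_setOf_or (definable_setOf_isBd hlt (W := fun v y => 0 < D j v y) (hPos j) _ _ hq' ht')
            (definable_setOf_isBd hlt (W := fun v y => D j v y < 0) (hNeg j) _ _ hq' ht'))))
  ----------------------------------------------------------------- (2) finiteness
  have hDef1 : ∀ j v, (univ : Set ℝ).Definable₁ L {y | 0 < D j v y} ∧ (univ : Set ℝ).Definable₁ L {y | D j v y < 0} := by
    intro j v
    unfold Set.Definable₁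
    exact ⟨definable_setOf_lt hlt (definableFun_const' _ _) ((hDdef j).definableFun_apply v),
      definable_setOf_lt hlt ((hDdef j).definableFun_apply v) (definableFun_const' _ _)⟩
  have hBadFin : ∀ j v, {x | Bad j v x}.Finite := by
    intro j v
    obtain ⟨d1, d2⟩ := hDef1 j v
    have hbig : ({0, 1} ∪ ({x | IsBd {y | 0 < D j v y} x} ∪ {x | IsBd {y | D j v y < 0} x})).Finite :=
      ((finite_singleton 1).insert 0).union ((finite_setOf_isBd_of_definable₁ hO d1).union
        (finite_setOf_isBd_of_definable₁ hO d2))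
    refine hbig.subset fun x hx => ?_
    rcases hx with h | h | ⟨-, h | h⟩
    · exact Or.inl (by simp [h])
    · exact Or.inl (by simp [h])
    · exact Or.inr (Or.inl h)
    · exact Or.inr (Or.inr h)
  ----------------------------------------------------------------- (3) uniform finiteness
  obtain ⟨N₁, hN₁⟩ : ∃ N₁ : ℕ, ∀ j (v : Fin q → ℝ), {x | Bad j v x}.ncard ≤ N₁ := by
    have hone : ∀ j, ∃ N : ℕ, ∀ v : Fin q → ℝ, {x | Bad j v x}.ncard ≤ N := by
      intro j
      set Y : Set (Fin (q + 1) → ℝ) := {w | Bad j (Fin.init w) (w (Fin.last q))} with hY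
      have hYdef : (univ : Set ℝ).Definable L Y :=
        (hBadDef j).preimage_comp (Sum.elim Fin.castSucc (fun _ => Fin.last q) : Fin q ⊕ Unit → Fin (q + 1))
      have hfib : ∀ v : Fin q → ℝ, {x | (Fin.snoc v x : Fin (q + 1) → ℝ) ∈ Y} = {x | Bad j v x} := by
        intro v; ext x; simp only [hY, mem_setOf_eq, Fin.init_snoc, Fin.snoc_last]
      obtain ⟨N, hN⟩ := CellDecomposition.uniformFiniteness hO hlt Y hYdef fun v => by
        rw [hfib]; exact hBadFin j v
      exact ⟨N, fun v => (hfib v) ▸ hN v⟩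
    choose N hN using hone
    exact ⟨Finset.univ.sup N, fun j v => (hN j v).trans (Finset.le_sup (Finset.mem_univ j))⟩
  ----------------------------------------------------------------- (4) enumeration and gaps
  set b : J → ℕ → (Fin q → ℝ) → ℝ := fun j i => nthPointT (Bad j) i with hb
  have hbDef : ∀ j i, (univ : Set ℝ).DefinableFun L (b j i) := fun j i =>
    definableFun_nthPointT hlt (hBadDef j) (hBadFin j) i
  have hBad01 : ∀ j v t, Bad j v t → 0 ≤ t ∧ t ≤ 1 := by
    intro j v t ht
    rcases ht with rfl | rfl | ⟨⟨h1, h2⟩, -⟩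
    · exact ⟨le_rfl, zero_le_one⟩
    · exact ⟨zero_le_one, le_rfl⟩
    · exact ⟨h1.le, h2.le⟩
  have hBad0 : ∀ j v, Bad j v 0 := fun j v => Or.inl rfl
  have hBad1 : ∀ j v, Bad j v 1 := fun j v => Or.inr (Or.inl rfl)
  have hgap : ∀ j v i, i + 1 < {x | Bad j v x}.ncard →
      b j i v < b j (i + 1) v ∧ Ioo (b j i v) (b j (i + 1) v) ⊆ Ioo 0 1 ∧
      ∀ y ∈ Ioo (b j i v) (b j (i + 1) v), ¬ Bad j v y := by
    intro j v i hi
    obtain ⟨hlt', hno⟩ := nthPointT_consecutive (hBadFin j v) hi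
    have hmemi : Bad j v (b j i v) := nthPointT_mem (hBadFin j v) (by omega)
    have hmemi1 : Bad j v (b j (i + 1) v) := nthPointT_mem (hBadFin j v) hi
    exact ⟨hlt', fun y hy => ⟨(hBad01 j v _ hmemi).1.trans_lt hy.1, hy.2.trans_le (hBad01 j v _ hmemi1).2⟩,
      fun y hy hbad => hno y hbad hy⟩
  -- on a gap: strictly monotone, strictly antitone, or constant
  have htricho : ∀ j v i, i + 1 < {x | Bad j v x}.ncard →
      StrictMonoOn (Ψ j v) (Ioo (b j i v) (b j (i + 1) v)) ∨ StrictAntiOn (Ψ j v) (Ioo (b j i v) (b j (i + 1) v)) ∨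
        ∀ x ∈ Ioo (b j i v) (b j (i + 1) v), ∀ y ∈ Ioo (b j i v) (b j (i + 1) v), Ψ j v x = Ψ j v y := by
    intro j v i hi
    obtain ⟨hlt', hsub, hnb⟩ := hgap j v i hi
    obtain ⟨d1, d2⟩ := hDef1 j v
    have hnb' : ∀ z ∈ Ioo (b j i v) (b j (i + 1) v), ¬ IsBd {y | 0 < D j v y} z ∧ ¬ IsBd {y | D j v y < 0} z := by
      intro z hz
      have h := hnb z hz
      simp only [hBad, not_or, not_and] at h
      exact h.2.2 ⟨(hsub hz).1, (hsub hz).2⟩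
    have hdiff' : DifferentiableOn ℝ (Ψ j v) (Ioo (b j i v) (b j (i + 1) v)) := (hdiff j v).mono hsub
    have hderiv : ∀ x ∈ Ioo (b j i v) (b j (i + 1) v), deriv (Ψ j v) x = D j v x := fun x _ => rfl
    rcases Ioo_subset_or_disjoint_of_forall_not_isBd hO hlt d1 (fun z hz => (hnb' z hz).1) with hpos | hpos
    · left
      exact strictMonoOn_of_deriv_pos (convex_Ioo _ _)
        (hdiff'.continuousOn) fun x hx => by rw [interior_Ioo] at hx; exact hpos hx
    rcases Ioo_subset_or_disjoint_of_forall_not_isBd hO hlt d2 (fun z hz => (hnb' z hz).2) with hneg | hneg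
    · right; left
      exact strictAntiOn_of_deriv_neg (convex_Ioo _ _)
        (hdiff'.continuousOn) fun x hx => by rw [interior_Ioo] at hx; exact hneg hx
    · right; right
      have hzero : EqOn (deriv (Ψ j v)) 0 (Ioo (b j i v) (b j (i + 1) v)) := by
        intro x hx
        have h1 : ¬ 0 < D j v x := fun h => Set.disjoint_left.mp hpos hx h
        have h2 : ¬ D j v x < 0 := fun h => Set.disjoint_left.mp hneg hx h
        show D j v x = 0
        push Not at h1 h2; exact le_antisymm h1 h2
      intro x hx y hy
      exact isOpen_Ioo.is_const_of_deriv_eq_zero isPreconnected_Ioo hdiff' hzero hx hy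
  ----------------------------------------------------------------- (5) the data
  set Gen : J → ℕ → (Fin q → ℝ) → Prop := fun j i v => i + 1 < {x | Bad j v x}.ncard with hGen
  have hGenDef : ∀ j i, (univ : Set ℝ).Definable L {v : Fin q → ℝ | Gen j i v} := by
    intro j i
    have h := FinitenessLemma.definable_setOf_le_ncard_of hlt (hBadDef j) (hBadFin j) (i + 2)
    convert h using 1
    ext v; simp only [mem_setOf_eq]; omega
  -- activity: genuine gap on which `Ψ_j(v,·)` is not constant (its derivative does not vanish identically)
  set Act : J → Fin N₁ → (Fin q → ℝ) → Prop := fun j i v =>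
    Gen j i v ∧ ∃ y, (b j i v < y ∧ y < b j (i + 1) v) ∧ (0 < D j v y ∨ D j v y < 0) with hAct
  have hActDef : ∀ j i, (univ : Set ℝ).Definable L {v | Act j i v} := by
    intro j i
    refine (hGenDef j i).inter ?_
    apply definable_setOf_exists
    refine definable_setOf_and (definable_setOf_and
      (definable_setOf_lt hlt ((hbDef j i).comp hq') ht') (definable_setOf_lt hlt ht' ((hbDef j (i + 1)).comp hq'))) ?_
    exact definable_setOf_or (hPos j) (hNeg j)
  refine ⟨N₁, fun j i => b j i, fun j i => b j (i + 1), Act, fun j i => hbDef j i, fun j i => hbDef j (i + 1),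
    hActDef, fun v => ⟨fun j i hact => ?_, ?_⟩⟩
  · ------------------------------------------------------------- active gaps
    obtain ⟨hgen, y, hy, hDy⟩ := hact
    obtain ⟨hlt', hsub, -⟩ := hgap j v i hgen
    refine ⟨hlt', hsub, ?_⟩
    rcases htricho j v i hgen with h | h | h
    · exact Or.inl h
    · exact Or.inr h
    · exfalso
      -- constant on the gap forces `D = 0` at `y`
      have hconst : ∀ᶠ x in 𝓝 y, Ψ j v x = Ψ j v y := by
        filter_upwards [isOpen_Ioo.mem_nhds (show y ∈ Ioo (b j i v) (b j (i + 1) v) from hy)] with x hx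
        exact h x hx y hy
      have hd : deriv (Ψ j v) y = 0 := by
        rw [Filter.EventuallyEq.deriv_eq hconst]; exact deriv_const y _
      have : D j v y = 0 := hd
      rcases hDy with h' | h' <;> linarith
  · ------------------------------------------------------------- the exceptional values
    refine ⟨(⋃ j, Ψ j v '' {x | Bad j v x}) ∪
        ⋃ j, ⋃ i ∈ Finset.range N₁, {Ψ j v ((b j i v + b j (i + 1) v) / 2)}, ?_, ?_⟩
    · exact (finite_iUnion fun j => (hBadFin j v).image _).union
        (finite_iUnion fun j => Finset.finite_toSet _ |>.biUnion fun i _ => finite_singleton _)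
    · intro j t ht
      by_cases hbt : Bad j v t
      · exact Or.inl (Or.inl (mem_iUnion.mpr ⟨j, t, hbt, rfl⟩))
      · obtain ⟨i, hi, hti, hti1, -⟩ :=
          exists_nthPointT_gap (hBadFin j v) hbt ⟨0, hBad0 j v, ht.1⟩ ⟨1, hBad1 j v, ht.2⟩
        have hiN : i < N₁ := by have := hN₁ j v; omega
        by_cases hact : Act j ⟨i, hiN⟩ v
        · exact Or.inr ⟨⟨i, hiN⟩, hact, hti, hti1⟩
        · -- inactive genuine gap: `Ψ_j(v,·)` is constant there
          left; right
          simp only [hAct, not_and, not_exists] at hact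
          have hnoD := hact hi
          rcases htricho j v i hi with h | h | h
          · exfalso
            -- strictly monotone with identically vanishing derivative: impossible
            obtain ⟨hlt', hsub, -⟩ := hgap j v i hi
            have hzero : ∀ y ∈ Ioo (b j i v) (b j (i + 1) v), deriv (Ψ j v) y = 0 := by
              intro y hy
              have h1 := hnoD y ⟨hy.1, hy.2⟩
              show D j v y = 0
              rcases lt_trichotomy (D j v y) 0 with h' | h' | h'
              · exact absurd (Or.inr h') h1
              · exact h'
              · exact absurd (Or.inl h') h1
            have hm : (b j i v + t) / 2 ∈ Ioo (b j i v) (b j (i + 1) v) := ⟨by linarith, by linarith⟩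
            have hc := isOpen_Ioo.is_const_of_deriv_eq_zero isPreconnected_Ioo ((hdiff j v).mono hsub)
              (fun y hy => hzero y hy) hm ⟨hti, hti1⟩
            have := h hm ⟨hti, hti1⟩ (by linarith)
            rw [hc] at this
            exact lt_irrefl _ this
          · exfalso
            obtain ⟨hlt', hsub, -⟩ := hgap j v i hi
            have hzero : ∀ y ∈ Ioo (b j i v) (b j (i + 1) v), deriv (Ψ j v) y = 0 := by
              intro y hy
              have h1 := hnoD y ⟨hy.1, hy.2⟩
              show D j v y = 0
              rcases lt_trichotomy (D j v y) 0 with h' | h' | h'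
              · exact absurd (Or.inr h') h1
              · exact h'
              · exact absurd (Or.inl h') h1
            have hm : (b j i v + t) / 2 ∈ Ioo (b j i v) (b j (i + 1) v) := ⟨by linarith, by linarith⟩
            have hc := isOpen_Ioo.is_const_of_deriv_eq_zero isPreconnected_Ioo ((hdiff j v).mono hsub)
              (fun y hy => hzero y hy) hm ⟨hti, hti1⟩
            have := h hm ⟨hti, hti1⟩ (by linarith)
            rw [hc] at this
            exact lt_irrefl _ this
          · have hm : (b j i v + b j (i + 1) v) / 2 ∈ Ioo (b j i v) (b j (i + 1) v) :=
              ⟨by linarith, by linarith⟩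
            have heq := h t ⟨hti, hti1⟩ _ hm
            rw [heq]
            exact mem_iUnion.mpr ⟨j, mem_iUnion₂.mpr ⟨i, Finset.mem_range.mpr hiN, rfl⟩⟩

end MonotonePieces

/-! ### Normalized strictly monotone charts, uniformly -/

section NormalizedCharts

open Classical

variable {L : Language} [L.Structure ℝ]

/-- The "first active chart" of a list, used to redirect inactive indices: a definable family
that agrees, whenever some index in the list is active, with the chart of an active index.
[folklore] -/
theorem exists_firstActive {K : Type} {q : ℕ} (φ : K → (Fin q → ℝ) → ℝ → ℝ) (Act : K → (Fin q → ℝ) → Prop)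
    (hφ : ∀ k, IsDefinableFamily₁ L (φ k)) (hAct : ∀ k, (univ : Set ℝ).Definable L {v | Act k v}) :
    ∀ l : List K, ∃ F : (Fin q → ℝ) → ℝ → ℝ, IsDefinableFamily₁ L F ∧
      ∀ v, (∃ k ∈ l, Act k v) → ∃ k ∈ l, Act k v ∧ ∀ t, F v t = φ k v t
  | [] => ⟨fun _ _ => 0, fun γ _ q t _ _ => definableFun_const' _ _, fun v ⟨k, hk, _⟩ => by simp at hk⟩
  | k :: l => by
    obtain ⟨F, hF, hspec⟩ := exists_firstActive φ Act hφ hAct l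
    refine ⟨fun v t => if Act k v then φ k v t else F v t, ?_, fun v hex => ?_⟩
    · intro γ _ qm tm hqm htm
      have hp : (univ : Set ℝ).Definable L (setOf fun u : γ → ℝ => Act k (qm u)) :=
        (hAct k).preimage_map hqm
      exact Set.DefinableFun.ite hp ((hφ k).definableFun hqm htm) (hF.definableFun hqm htm)
    · by_cases hk : Act k v
      · exact ⟨k, List.mem_cons_self, hk, fun t => by simp [hk]⟩
      · obtain ⟨k', hk'l, hk'⟩ := hex
        have hk'l' : k' ∈ l := by
          rcases List.mem_cons.mp hk'l with rfl | h
          · exact absurd hk' hk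
          · exact h
        obtain ⟨k'', hk''l, hact, hF⟩ := hspec v ⟨k', hk'l', hk'⟩
        exact ⟨k'', List.mem_cons_of_mem _ hk''l, hact, fun t => by simp [hk, hF t]⟩

/-- **Normalized strictly monotone charts, uniformly** (Bhardwaj–van den Dries 2022, proofs of
Thm. 4.3 and Lemma 6.2: *"by partitioning (0,1) further and composing with linear functions
we arrange that `φ` is given by a pair of normalized strictly monotone functions … throw away
the `φ ∈ Φ` for which `φ` is constant … replacing `𝕀` by a cofinite subset"*): from definable
families `Ψ_j(v,·)` of `C^r` functions `(0,1) → [0,1]` (`r ≥ 1`) with `|Ψ^{(i)}| ≤ 1` whose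
images cover `(0,1)` up to finitely many points, one gets finitely many definable families of
**strictly monotone** `C^r` charts `(0,1) → (0,1)` with `|φ^{(i)}| ≤ 1`, each an affine
reparametrization `t ↦ Ψ_j(v, α + (β−α)t)` of some `Ψ_j(v,·)` over a gap `(α, β) ⊆ (0,1)` on
which it is strictly monotone, and whose images still cover `(0,1)` up to finitely many points
(inactive indices are redirected to an active chart). [cite: BhardwajVanDenDries2022, Lemma 6.2 (proof)] -/
theorem normalized_charts (hO : L.IsOMinimal ℝ)
    (hadd : (univ : Set ℝ).Definable L {v : Fin 3 → ℝ | v 0 + v 1 = v 2})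
    (hmul : (univ : Set ℝ).Definable L {v : Fin 3 → ℝ | v 0 * v 1 = v 2})
    {q r : ℕ} (hr : 1 ≤ r) {J : Type} [Fintype J] (Ψ : J → (Fin q → ℝ) → ℝ → ℝ)
    (hΨ : ∀ j, IsDefinableFamily₁ L (Ψ j))
    (hCr : ∀ j v, ContDiffOn ℝ r (Ψ j v) (Ioo 0 1))
    (hbd : ∀ j v, ∀ i ≤ r, ∀ t ∈ Ioo (0 : ℝ) 1, |iteratedDerivWithin i (Ψ j v) (Ioo 0 1) t| ≤ 1)
    (hmaps : ∀ j v, MapsTo (Ψ j v) (Ioo 0 1) (Icc 0 1))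
    (hcof : ∀ v, (Ioo (0 : ℝ) 1 \ ⋃ j, Ψ j v '' Ioo 0 1).Finite) :
    ∃ (K : Type) (_ : Fintype K) (φ : K → (Fin q → ℝ) → ℝ → ℝ), (∀ k, IsDefinableFamily₁ L (φ k)) ∧
      ∀ v, (∀ k, ∃ j α β, α < β ∧ Ioo α β ⊆ Ioo 0 1 ∧
              (StrictMonoOn (Ψ j v) (Ioo α β) ∨ StrictAntiOn (Ψ j v) (Ioo α β)) ∧
              ∀ t, φ k v t = Ψ j v (α + (β - α) * t)) ∧
        (∀ k, StrictMonoOn (φ k v) (Ioo 0 1) ∨ StrictAntiOn (φ k v) (Ioo 0 1)) ∧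
        (∀ k, MapsTo (φ k v) (Ioo 0 1) (Ioo 0 1)) ∧
        (∀ k, ContDiffOn ℝ r (φ k v) (Ioo 0 1)) ∧
        (∀ k, ∀ i ≤ r, ∀ t ∈ Ioo (0 : ℝ) 1, |iteratedDerivWithin i (φ k v) (Ioo 0 1) t| ≤ 1) ∧
        (Ioo (0 : ℝ) 1 \ ⋃ k, φ k v '' Ioo 0 1).Finite := by
  have hdiff : ∀ j v, DifferentiableOn ℝ (Ψ j v) (Ioo 0 1) := fun j v =>
    (hCr j v).differentiableOn (by exact_mod_cast Nat.one_le_iff_ne_zero.mp hr)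
  obtain ⟨N, α, β, Act, hαdef, hβdef, hActdef, hpieces⟩ := uniform_monotone_pieces hO hadd hmul Ψ hΨ hdiff
  -- raw charts and activity on `K = J × Fin N`
  set raw : J × Fin N → (Fin q → ℝ) → ℝ → ℝ := fun k v t =>
    Ψ k.1 v (α k.1 k.2 v + (β k.1 k.2 v - α k.1 k.2 v) * t) with hraw
  set Act' : J × Fin N → (Fin q → ℝ) → Prop := fun k v => Act k.1 k.2 v with hAct'
  have hrawdef : ∀ k, IsDefinableFamily₁ L (raw k) := by
    intro k γ _ qm tm hqm htm
    have ha := (hαdef k.1 k.2).comp hqm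
    have hb := (hβdef k.1 k.2).comp hqm
    exact (hΨ k.1).definableFun hqm (definableFun_add hadd ha (definableFun_mul hmul (definableFun_sub hadd hb ha) htm))
  have hAct'def : ∀ k, (univ : Set ℝ).Definable L {v | Act' k v} := fun k => hActdef k.1 k.2
  obtain ⟨F, hFdef, hFspec⟩ := exists_firstActive raw Act' hrawdef hAct'def (Finset.univ.toList)
  set φ : J × Fin N → (Fin q → ℝ) → ℝ → ℝ := fun k v t => if Act' k v then raw k v t else F v t with hφ
  have hφdef : ∀ k, IsDefinableFamily₁ L (φ k) := by
    intro k γ _ qm tm hqm htm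
    exact Set.DefinableFun.ite ((hAct'def k).preimage_map hqm) ((hrawdef k).definableFun hqm htm) (hFdef.definableFun hqm htm)
  refine ⟨J × Fin N, inferInstance, φ, hφdef, fun v => ?_⟩
  obtain ⟨hact, E, hEfin, hE⟩ := hpieces v
  ----------------------------------------------------------------- some gap is active
  have hex : ∃ k ∈ Finset.univ.toList, Act' k v := by
    by_contra hnone
    push Not at hnone
    have hall : ∀ j, ∀ t ∈ Ioo (0 : ℝ) 1, Ψ j v t ∈ E := by
      intro j t ht
      rcases hE j t ht with h | ⟨i, hi, -⟩
      · exact h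
      · exact absurd hi (hnone (j, i) (Finset.mem_toList.mpr (Finset.mem_univ _)))
    have hsub : Ioo (0 : ℝ) 1 \ E ⊆ Ioo (0 : ℝ) 1 \ ⋃ j, Ψ j v '' Ioo 0 1 := by
      rintro y ⟨hy, hyE⟩
      refine ⟨hy, fun hmem => hyE ?_⟩
      obtain ⟨j, t, ht, rfl⟩ := by simpa only [mem_iUnion, mem_image] using hmem
      exact hall j t ht
    have hinf : (Ioo (0 : ℝ) 1 \ E).Infinite := (Ioo_infinite zero_lt_one).sdiff hEfin
    exact hinf ((hcof v).subset hsub)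
  -- every chart is a raw chart of an active gap
  have hsource : ∀ k, ∃ k', Act' k' v ∧ ∀ t, φ k v t = raw k' v t := by
    intro k
    by_cases hk : Act' k v
    · exact ⟨k, hk, fun t => by simp [hφ, hk]⟩
    · obtain ⟨k', -, hk', hF⟩ := hFspec v hex
      exact ⟨k', hk', fun t => by simp [hφ, hk, hF t]⟩
  ----------------------------------------------------------------- properties of raw active charts
  have hrawprops : ∀ k, Act' k v →
      (StrictMonoOn (raw k v) (Ioo 0 1) ∨ StrictAntiOn (raw k v) (Ioo 0 1)) ∧
      MapsTo (raw k v) (Ioo 0 1) (Ioo 0 1) ∧ ContDiffOn ℝ r (raw k v) (Ioo 0 1) ∧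
      ∀ i ≤ r, ∀ t ∈ Ioo (0 : ℝ) 1, |iteratedDerivWithin i (raw k v) (Ioo 0 1) t| ≤ 1 := by
    rintro ⟨j, i⟩ hk
    obtain ⟨hlt', hsub, hmono⟩ := hact j i hk
    set a := α j i v with ha
    set b := β j i v with hb
    have haff : MapsTo (fun t => a + (b - a) * t) (Ioo (0 : ℝ) 1) (Ioo a b) := mapsTo_affine_Ioo hlt'
    have haffI : MapsTo (fun t => a + (b - a) * t) (Ioo (0 : ℝ) 1) (Ioo 0 1) := fun t ht => hsub (haff ht)
    have haffmono : StrictMono (fun t : ℝ => a + (b - a) * t) := fun x y hxy => by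
      simp only; nlinarith
    have hrawk : raw (j, i) v = fun t => Ψ j v (a + (b - a) * t) := rfl
    refine ⟨?_, ?_, ?_, ?_⟩
    · rcases hmono with h | h
      · left; rw [hrawk]
        exact fun x hx y hy hxy => h (haff hx) (haff hy) (haffmono hxy)
      · right; rw [hrawk]
        exact fun x hx y hy hxy => h (haff hx) (haff hy) (haffmono hxy)
    · -- values in `(0,1)`: strictly between two values in `[0,1]`
      intro t ht
      rw [hrawk]
      set s := a + (b - a) * t with hs
      have hsab : s ∈ Ioo a b := haff ht
      obtain ⟨s₁, hs₁⟩ : ∃ s₁, s₁ ∈ Ioo a s := ⟨(a + s) / 2, by constructor <;> linarith [hsab.1]⟩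
      obtain ⟨s₂, hs₂⟩ : ∃ s₂, s₂ ∈ Ioo s b := ⟨(s + b) / 2, by constructor <;> linarith [hsab.2]⟩
      have hs₁ab : s₁ ∈ Ioo a b := ⟨hs₁.1, hs₁.2.trans hsab.2⟩
      have hs₂ab : s₂ ∈ Ioo a b := ⟨hsab.1.trans hs₂.1, hs₂.2⟩
      have h1 := hmaps j v (hsub hs₁ab)
      have h2 := hmaps j v (hsub hs₂ab)
      rcases hmono with h | h
      · exact ⟨h1.1.trans_lt (h hs₁ab hsab hs₁.2), (h hsab hs₂ab hs₂.1).trans_le h2.2⟩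
      · exact ⟨h2.1.trans_lt (h hsab hs₂ab hs₂.1), (h hs₁ab hsab hs₁.2).trans_le h1.2⟩
    · rw [hrawk]
      exact (hCr j v).comp ((contDiff_const.add (contDiff_const.mul contDiff_id)).contDiffOn) haffI
    · intro n hn t ht
      rw [hrawk]
      have hq1 : |b - a| ≤ 1 := by
        rw [abs_of_pos (by linarith)]
        have := (hsub (haff (show (1/2 : ℝ) ∈ Ioo (0:ℝ) 1 from ⟨by norm_num, by norm_num⟩)))
        -- `a ≥ 0` and `b ≤ 1` since `(a, b) ⊆ (0, 1)` and `a < b`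
        have ha0 : 0 ≤ a := by
          by_contra h; push Not at h
          have hm : min (a / 2) 0 ∈ Ioo a b ∨ (a + min b 0) / 2 ∈ Ioo a b := by
            right; constructor
            · have : min b 0 ≤ 0 := min_le_right _ _
              have : a < min b 0 := lt_min hlt' h
              linarith
            · have : min b 0 ≤ b := min_le_left _ _
              have : a < min b 0 := lt_min hlt' h
              linarith [this]
          rcases hm with hm | hm
          · exact absurd (hsub hm).1 (by push Not; exact (min_le_right _ _))
          · have := (hsub hm).1
            have : min b 0 ≤ 0 := min_le_right _ _
            have : a < min b 0 := lt_min hlt' h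
            linarith
        have hb1 : b ≤ 1 := by
          by_contra h; push Not at h
          have hm : (max a 1 + b) / 2 ∈ Ioo a b := by
            constructor
            · have : a ≤ max a 1 := le_max_left _ _
              have : max a 1 < b := max_lt hlt' h
              linarith
            · have : max a 1 < b := max_lt hlt' h
              linarith
          have := (hsub hm).2
          have : 1 ≤ max a 1 := le_max_right _ _
          have : max a 1 < b := max_lt hlt' h
          linarith
        linarith
      exact (abs_iteratedDerivWithin_comp_affine_le isOpen_Ioo hq1 haffI ((hCr j v).of_le (by exact_mod_cast hn)) ht).trans
        (hbd j v n hn _ (haffI ht))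
  refine ⟨fun k => ?_, fun k => ?_, fun k => ?_, fun k => ?_, fun k => ?_, ?_⟩
  · obtain ⟨⟨j, i⟩, hk', hφk⟩ := hsource k
    obtain ⟨hlt', hsub, hmono⟩ := hact j i hk'
    exact ⟨j, α j i v, β j i v, hlt', hsub, hmono, fun t => hφk t⟩
  · obtain ⟨k', hk', hφk⟩ := hsource k
    have heq : φ k v = raw k' v := funext hφk
    rw [heq]; exact (hrawprops k' hk').1
  · obtain ⟨k', hk', hφk⟩ := hsource k
    have heq : φ k v = raw k' v := funext hφk
    rw [heq]; exact (hrawprops k' hk').2.1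
  · obtain ⟨k', hk', hφk⟩ := hsource k
    have heq : φ k v = raw k' v := funext hφk
    rw [heq]; exact (hrawprops k' hk').2.2.1
  · obtain ⟨k', hk', hφk⟩ := hsource k
    have heq : φ k v = raw k' v := funext hφk
    rw [heq]; exact (hrawprops k' hk').2.2.2
  · ------------------------------------------------------------- cofinite cover
    refine ((hcof v).union hEfin).subset ?_
    rintro y ⟨hy, hnot⟩
    by_cases hyc : y ∈ ⋃ j, Ψ j v '' Ioo 0 1
    · right
      obtain ⟨j, t, ht, rfl⟩ := by simpa only [mem_iUnion, mem_image] using hyc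
      rcases hE j t ht with h | ⟨i, hi, hti⟩
      · exact h
      · exfalso
        apply hnot
        obtain ⟨hlt', -, -⟩ := hact j i hi
        refine mem_iUnion.mpr ⟨(j, i), (t - α j i v) / (β j i v - α j i v), ⟨div_pos (by linarith [hti.1]) (by linarith),
          (div_lt_one (by linarith)).mpr (by linarith [hti.2])⟩, ?_⟩
        have hk : Act' (j, i) v := hi
        simp only [hφ, hk, if_true, hraw]
        congr 1
        have hne : β j i v - α j i v ≠ 0 := by linarith
        field_simp
        ring
    · exact Or.inl ⟨hy, hyc⟩

end NormalizedCharts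


end Literature.ModelTheory.ExponentialFields

end
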